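import Summits.ResolutionOfSingularities.ResolutionOfSingularities.Theorems.HilbertSamuelEliminationSigmaMaxModificationsCorridor3SigmaBoundaryOnSurfaceList
import Literature.AlgebraicGeometry.Resolution.ControlledTransformBaseChange
import Literature.AlgebraicGeometry.Resolution.AlterationsNormalFormStrictTransform
import Literature.AlgebraicGeometry.Resolution.BlowupSequencesLocalIsoDescent
import Literature.AlgebraicGeometry.Resolution.BlowupRestrictOpen
import HarnessLib

/-!
# [OURS · L1 W4.2] σ-LAYER (P1*) — `Corridor3SigmaSurfaceStrictTransform`: the W → D̃ glue for ONE blow-up — the transformed surface IS the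
# blow-up of the surface (carrier, general stage), and the TRACE LAWS (t1)/(t2) for boundary members admitting the exact factorization
# `𝓘(F) · B′ = π^*B` (= CJS's principal strict transform), BY NAME from Literature

res-L1-w42-plan-1 RULING v3.14-36 (IC) («`…SigmaSurfaceStrictTransform` = instantiation + `restrictOff` bookkeeping + ℓ-glue; 067 takes it at 15:30Z if
001 is not seated») as AUDITED by res-type-067 WORD 15:05:01Z: the hypersurface glue (g1)/(g2) needs a REGULAR stage and does not instantiate (the σ-layer
stage `W` is the singular scheme, `D̃ ⊆ X(ν)`); the carrier glue holds for a GENERAL stage (GW 13.91/13.96); the member glue is the tree's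
`comap_controlledTransform_of_isEffectiveCartier` = CJS 2020 Lemma 4.8 (a) for the PRINCIPAL strict transform `σᶜ(B,1)` (CJS Def. 4.5: the transform of
record of a boundary member containing the centre), and holds for ANY transform `B′` with `𝓘(F)·B′ = π^*B` — which forces `B′ = σᶜ(B,1)` (§2) — in
particular for the model's saturation `strictTransformIdeal` exactly when that factorization holds (CJS Rem. 4.6 (b): regular stage, regular member).
Typer res-type-067 (g12). OURS (cell res-hironaka, slot W4.2); NOT statements of [Hironaka2017]; the cited CJS items are DEFINITIONS/LEMMAS of
[CossartJannsenSaito2020] rendered through tree theorems, no new named fact. AI-typed. Helper `--supports stmt-ResolutionOfSingularities-19249 --as helper`.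

* §1 CARRIER (general stage, no regularity): for `ι : D ⟶ W` a closed immersion, a blow-up `π : W′ ⟶ W` of `C` and a blow-up `ρ : D′ ⟶ D` of `C|_D`,
  the comparison `j := hπ.strictTransformHom hρ : D′ ⟶ W′` (GW 13.91 (1)) is a closed immersion over `ι` (GW 13.96 (2)) with image the strict transform
  `strictTransformSet π |C| ι(D)`; `Sigma.surfaceNext π C Z : Closeds W′` names that image for `Z : Closeds W`, and **`isRegular_menuCentre_surfaceNext`**:
  if `D′` is regular then the reduced subscheme `(menuCentre (surfaceNext π C Z)).subscheme` of the next stage is regular (the `hReady`-half persists).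
* §2 TRACES: `eq_controlledTransform_one_of_mul_eq` (exact factorization forces `B′ = σᶜ(B,1)`); **`comap_strictTransformHom_controlledTransform`** (t1)/(t2)
  in one statement: `(σᶜ(B,μ)).comap j = ρᶜ(B|_D, μ)` for `B ≤ C^μ` (μ = 1: members through the centre); `comap_strictTransformHom_of_mul_eq` (any `B′`
  with `𝓘(F)·B′ = π^*B`); `comap_strictTransformHom_strictTransformIdeal_of_mul_eq` (the model's saturation transform, CONDITIONAL on the factorization);
  `comap_strictTransformHom_exceptional` (new member ↦ exceptional divisor of `ρ`); `exceptional_mul_controlledTransform_comap` (reading: `𝓘(C_D)·ρᶜ(Γ,1) =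
  ρ^*Γ`, i.e. the new trace is «`ρ^*Γ − C_D`» = `(m−1)·C_D + Γ̃` on a regular surface).
-/

noncomputable section

set_option linter.dupNamespace false

open CategoryTheory AlgebraicGeometry TopologicalSpace
open Literature.AlgebraicGeometry.Resolution

namespace Summit.ResolutionOfSingularities.ResolutionOfSingularities.Theorems.SigmaMaxModificationsCorridor3.Sigma

universe u

variable {W W' D D' : Scheme.{u}} {ι : D ⟶ W} {C : W.IdealSheafData} {π : W' ⟶ W} {ρ : D' ⟶ D}

/-! ## §1. The carrier: the transformed surface is the blow-up of the surface -/

/-- [OURS · L1 W4.2] **THE NEXT SURFACE** `Z′ := closure π⁻¹(Z ∖ |C|)` (strict transform of the closed set `Z` under the blow-up `π` of `C`), as a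
closed subset of the next stage. NOT a statement of the manuscript. [cite: GortzWedhorn2020, (13.19) p. 414] -/
def surfaceNext (π : W' ⟶ W) (C : W.IdealSheafData) (Z : Closeds W) : Closeds W' :=
  ⟨strictTransformSet π (C.support : Set W) (Z : Set W), strictTransformSet.isClosed π _ _⟩

/-- Unfolding `surfaceNext`. [folklore] -/
@[simp] theorem coe_surfaceNext (π : W' ⟶ W) (C : W.IdealSheafData) (Z : Closeds W) :
    ((surfaceNext π C Z : Closeds W') : Set W') = strictTransformSet π (C.support : Set W) (Z : Set W) :=
  rfl

/-- **The comparison morphism is a closed immersion** (GW Prop. 13.96 (2), tree `IsBlowup.isClosedImmersion_of_comp_eq`).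
[cite: GortzWedhorn2020, Prop. 13.96 (2), p. 416] -/
theorem isClosedImmersion_strictTransformHom [IsClosedImmersion ι] (hπ : IsBlowup π C) (hρ : IsBlowup ρ (C.comap ι)) :
    IsClosedImmersion (hπ.strictTransformHom hρ) :=
  hπ.isClosedImmersion_of_comp_eq hρ (hπ.strictTransformHom_comp hρ)

/-- **Its image is the strict transform of `ι(D)`** (tree `range_eq_strictTransformSet`). [cite: GortzWedhorn2020, Prop. 13.96 (2), p. 416] -/
theorem range_strictTransformHom [IsClosedImmersion ι] (hπ : IsBlowup π C) (hρ : IsBlowup ρ (C.comap ι)) :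
    Set.range (hπ.strictTransformHom hρ) = strictTransformSet π (C.support : Set W) (Set.range ι) :=
  haveI := isClosedImmersion_strictTransformHom hπ hρ
  hπ.range_eq_strictTransformSet hρ (hπ.strictTransformHom_comp hρ) (hπ.strictTransformHom hρ).isClosedEmbedding.isClosed_range

/-- … for the reduced surface `Z`: the image of `Bl_{C|_Z} Z ⟶ W′` is `surfaceNext π C Z`. [folklore] -/
theorem range_strictTransformHom_menuCentre {Z : Closeds W} (hπ : IsBlowup π C) {DZ : Scheme.{u}} {ρ : DZ ⟶ (menuCentre Z).subscheme}
    (hρ : IsBlowup ρ (C.comap (menuCentre Z).subschemeι)) :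
    Set.range (hπ.strictTransformHom hρ) = ((surfaceNext π C Z : Closeds W') : Set W') := by
  rw [range_strictTransformHom hπ hρ, coe_surfaceNext, Scheme.IdealSheafData.range_subschemeι, coe_support_menuCentre]

/-- **THE REGULAR HALF OF READINESS PERSISTS ALONG THE CARRIER**: if the blow-up `DZ = Bl_{C|_Z} Z` of the reduced surface is regular, then the reduced
subscheme of the next stage on `surfaceNext π C Z` is regular (it is the image of the closed immersion `DZ ⟶ W′`; tree
`isRegular_subscheme_vanishingIdeal_range`). General stage, no regularity of `W`. [folklore] -/
theorem isRegular_menuCentre_surfaceNext {Z : Closeds W} (hπ : IsBlowup π C) {DZ : Scheme.{u}} {ρ : DZ ⟶ (menuCentre Z).subscheme}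
    (hρ : IsBlowup ρ (C.comap (menuCentre Z).subschemeι)) (hreg : Scheme.IsRegular DZ) :
    Scheme.IsRegular (menuCentre (surfaceNext π C Z)).subscheme := by
  haveI := isClosedImmersion_strictTransformHom hπ hρ
  have h := isRegular_subscheme_vanishingIdeal_range (hπ.strictTransformHom hρ) hreg
  have hZ : (⟨Set.range (hπ.strictTransformHom hρ), (hπ.strictTransformHom hρ).isClosedEmbedding.isClosed_range⟩ : Closeds W') =
      surfaceNext π C Z :=
    Closeds.ext (range_strictTransformHom_menuCentre hπ hρ)
  rwa [hZ] at h

/-- **THE NEXT REDUCED SURFACE IS THE BLOW-UP OF THE SURFACE**: for `DZ = Bl_{C|_Z} Z` reduced (e.g. regular), an isomorphism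
`e : DZ ≅ (menuCentre (surfaceNext π C Z)).subscheme` over `W′` with `e.hom ≫ ι′ = j` (`ι′` the inclusion of the reduced next surface, `j` the comparison
morphism): the closed immersion `j` and `ι′` have the same kernel `𝓘(Z′)` (tree `ker_eq_vanishingIdeal_range`, Mathlib `IsClosedImmersion.isIso_lift`).
General stage. [cite: GortzWedhorn2020, Prop. 13.96 (2), p. 416] -/
theorem exists_iso_menuCentre_surfaceNext {Z : Closeds W} (hπ : IsBlowup π C) {DZ : Scheme.{u}} {ρ : DZ ⟶ (menuCentre Z).subscheme}
    (hρ : IsBlowup ρ (C.comap (menuCentre Z).subschemeι)) [IsReduced DZ] :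
    ∃ e : DZ ≅ (menuCentre (surfaceNext π C Z)).subscheme,
      e.hom ≫ (menuCentre (surfaceNext π C Z)).subschemeι = hπ.strictTransformHom hρ := by
  haveI := isClosedImmersion_strictTransformHom hπ hρ
  set j := hπ.strictTransformHom hρ with hj
  have hZ : (⟨Set.range j, j.isClosedEmbedding.isClosed_range⟩ : Closeds W') = surfaceNext π C Z :=
    Closeds.ext (range_strictTransformHom_menuCentre hπ hρ)
  have hker : (menuCentre (surfaceNext π C Z)).subschemeι.ker = j.ker := by
    rw [Scheme.IdealSheafData.ker_subschemeι, ker_eq_vanishingIdeal_range j j.isClosedEmbedding.isClosed_range, hZ]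
  haveI := IsClosedImmersion.isIso_lift _ j hker
  exact ⟨asIso (IsClosedImmersion.lift _ j hker.le), IsClosedImmersion.lift_fac _ j hker.le⟩

/-! ## §1b. Reading readiness on the blow-up: transport of `restrictOff` / `SncListOn` along the comparison -/

/-- **`restrictOff` is computed member-wise along any factorisation**: restricting along `ι′` and pulling back along `e` is restricting along `e ≫ ι′`
as soon as `e` is surjective (the filter «member does not contain the image» sees the same image). Pure bookkeeping. [folklore] -/
theorem Boundary.restrictOff_map_comap {S DZ : Scheme.{u}} (E' : Boundary W') (ι' : S ⟶ W') (e : DZ ⟶ S) [Surjective e] :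
    (E'.restrictOff ι').map (fun J => J.comap e) = E'.restrictOff (e ≫ ι') := by
  classical
  have hr : Set.range (e ≫ ι').base = Set.range ι'.base := by
    rw [Scheme.Hom.comp_base, TopCat.coe_comp, Set.range_comp, e.surjective.range_eq, Set.image_univ]
  simp only [Boundary.restrictOff, List.map_map, hr]
  refine List.map_congr_left fun I _ => ?_
  simp [Scheme.IdealSheafData.comap_comp]

/-- **SNC OF A LIST IS INVARIANT UNDER ISOMORPHISMS** (both directions from Literature: `HasSNCWith.comap_of_isOpenImmersion` and the descent
`HasSNCWith.of_comap_of_isLocalIso`). [folklore] -/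
theorem hasSNC_map_comap_iff_of_isIso {S DZ : Scheme.{u}} [IsLocallyNoetherian S] (L : List S.IdealSheafData) (e : DZ ⟶ S) [IsIso e] :
    HasSNC (L.map (fun J => J.comap e)) ↔ HasSNC L := by
  constructor
  · intro h
    have h' : HasSNCWith (L.map (fun J => J.comap e)) ((⊤ : S.IdealSheafData).comap e) := by
      rwa [Scheme.IdealSheafData.comap_top]
    exact HasSNCWith.of_comap_of_isLocalIso e h'
  · intro h
    have h' := HasSNCWith.comap_of_isOpenImmersion e h
    rwa [Scheme.IdealSheafData.comap_top] at h'

/-- **READINESS (snc half) OF THE NEXT SURFACE READS ON THE BLOW-UP OF THE SURFACE**: with `e ≫ ι′ = j` an isomorphism onto the reduced next surface,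
`SncListOn E′ ι′ ↔ HasSNC (E′.restrictOff j)` — the traces of the next boundary along the comparison morphism `j : Bl_{C|_Z} Z ⟶ W′`. TRANSFORM-AGNOSTIC
(`E′` is any boundary of the next stage). [folklore] -/
theorem Boundary.sncListOn_iff_hasSNC_restrictOff_comp {S DZ : Scheme.{u}} [IsLocallyNoetherian S] (E' : Boundary W') (ι' : S ⟶ W')
    (e : DZ ⟶ S) [IsIso e] : E'.SncListOn ι' ↔ HasSNC (E'.restrictOff (e ≫ ι')) := by
  rw [← Boundary.restrictOff_map_comap E' ι' e, hasSNC_map_comap_iff_of_isIso]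

/-! ## §2. Traces: the member laws along the comparison morphism -/

/-- **EXACT FACTORIZATION FORCES THE PRINCIPAL STRICT TRANSFORM**: if `𝓘(F) · B′ = π^*B` on the blown-up stage then `B′ = σᶜ(B, 1)` (the exceptional
divisor is effective Cartier and cancels; tree `colon_pow_eq_of_mul_eq`). So «any transform with the factorization» below IS CJS's principal strict
transform (Def. 4.5) in tree language. [cite: CossartJannsenSaito2020, Def. 4.5] -/
theorem eq_controlledTransform_one_of_mul_eq (hπ : IsBlowup π C) {B : W.IdealSheafData} {B' : W'.IdealSheafData}
    (h : C.comap π * B' = B.comap π) : B' = controlledTransform π C B 1 := by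
  rw [controlledTransform, pow_one]
  have h1 : C.comap π ^ 1 * B' = B.comap π := by rwa [pow_one]
  rw [← colon_pow_eq_of_mul_eq hπ.isEffectiveCartier h1, pow_one]

/-- **(t1)/(t2) — RESTRICTION TO THE SURFACE COMMUTES WITH THE CONTROLLED TRANSFORM** (CJS 2020 Lemma 4.8 (a) `(𝓑_Y)′ = (𝓑′)_{Y′}`; tree
`comap_controlledTransform_of_isEffectiveCartier` along the square `j ≫ π = ρ ≫ ι`): for a member `B ≤ C^μ` (μ = 1: the centre lies in the member),
`σᶜ(B, μ)|_{D′} = ρᶜ(B|_D, μ)`. GENERAL STAGE — no regularity of `W` or `D`. [cite: CossartJannsenSaito2020, Lemma 4.8 (a)] -/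
theorem comap_strictTransformHom_controlledTransform [IsLocallyNoetherian W'] (hπ : IsBlowup π C) (hρ : IsBlowup ρ (C.comap ι))
    {B : W.IdealSheafData} {μ : ℕ} (hB : B ≤ C ^ μ) :
    (controlledTransform π C B μ).comap (hπ.strictTransformHom hρ) = controlledTransform ρ (C.comap ι) (B.comap ι) μ := by
  have hsq := hπ.strictTransformHom_comp hρ
  refine comap_controlledTransform_of_isEffectiveCartier ι hsq C B μ hπ.isEffectiveCartier (comap_le_comap_pow_of_le_pow hB π) ?_
  rw [comap_comap_eq_of_comp_eq hsq]
  exact hρ.isEffectiveCartier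

/-- **(t1)/(t2) FOR ANY TRANSFORM WITH THE EXACT FACTORIZATION** `𝓘(F) · B′ = π^*B` (then `B ≤ C` automatically is not needed as a hypothesis: the
factorization gives `π^*B ≤ 𝓘(F)`): `B′|_{D′} = ρᶜ(B|_D, 1)`. [cite: CossartJannsenSaito2020, Lemma 4.8 (a)] -/
theorem comap_strictTransformHom_of_mul_eq [IsLocallyNoetherian W'] (hπ : IsBlowup π C) (hρ : IsBlowup ρ (C.comap ι))
    {B : W.IdealSheafData} {B' : W'.IdealSheafData} (h : C.comap π * B' = B.comap π) :
    B'.comap (hπ.strictTransformHom hρ) = controlledTransform ρ (C.comap ι) (B.comap ι) 1 := by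
  have hsq := hπ.strictTransformHom_comp hρ
  have hle : B.comap π ≤ C.comap π ^ 1 := by rw [pow_one, ← h]; exact fun _ => Ideal.mul_le_right
  have hDs : IsEffectiveCartier ((C.comap π).comap (hπ.strictTransformHom hρ)) := by
    rw [comap_comap_eq_of_comp_eq hsq]; exact hρ.isEffectiveCartier
  rw [eq_controlledTransform_one_of_mul_eq hπ h]
  exact comap_controlledTransform_of_isEffectiveCartier ι hsq C B 1 hπ.isEffectiveCartier hle hDs

/-- **THE MODEL'S SATURATION TRANSFORM, CONDITIONALLY**: if the scheme-theoretic strict transform `B̃ = ⋃ₙ (π^*B : 𝓘(F)ⁿ)` (tree `strictTransformIdeal`,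
the member update of `Boundary.next`) satisfies the exact factorization `𝓘(F) · B̃ = π^*B` (CJS Rem. 4.6 (b): e.g. regular stage and regular member
through a regular centre), then `B̃|_{D′} = ρᶜ(B|_D, 1)`. Without the factorization this FAILS (res-type-067 WORD 15:05:01Z: `W = 𝔸³`, `D = {z = 0}`,
`B = {z = x²}`, point centre). [cite: CossartJannsenSaito2020, Rem. 4.6] -/
theorem comap_strictTransformHom_strictTransformIdeal_of_mul_eq [IsLocallyNoetherian W'] (hπ : IsBlowup π C) (hρ : IsBlowup ρ (C.comap ι))
    {B : W.IdealSheafData} (h : C.comap π * strictTransformIdeal π C B = B.comap π) :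
    (strictTransformIdeal π C B).comap (hπ.strictTransformHom hρ) = controlledTransform ρ (C.comap ι) (B.comap ι) 1 :=
  comap_strictTransformHom_of_mul_eq hπ hρ h

/-- **THE NEW MEMBER RESTRICTS TO THE EXCEPTIONAL DIVISOR OF `ρ`**: `𝓘(F)|_{D′} = ρ^*(C|_D)` (CJS Lemma 4.8 (a), last clause; tree
`comap_comap_eq_of_comp_eq`). [cite: CossartJannsenSaito2020, Lemma 4.8 (a)] -/
theorem comap_strictTransformHom_exceptional (hπ : IsBlowup π C) (hρ : IsBlowup ρ (C.comap ι)) :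
    (C.comap π).comap (hπ.strictTransformHom hρ) = (C.comap ι).comap ρ :=
  comap_comap_eq_of_comp_eq (hπ.strictTransformHom_comp hρ)

/-- **READING (t1) ON THE SURFACE**: the new trace `Γ′ := ρᶜ(Γ, 1)` of a member through the centre satisfies `𝓘(C_D) · Γ′ = ρ^*Γ` — «`Γ′ = ρ^*Γ − C_D`»,
i.e. on a regular surface with a point centre `q` of multiplicity `m = mult_q Γ`: `Γ′ = (m − 1)·C_D + Γ̃` (tree `IsBlowup.pow_mul_controlledTransform_eq`).
[cite: CossartJannsenSaito2020, (4.2)–(4.3)] -/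
theorem exceptional_mul_controlledTransform_comap [IsLocallyNoetherian D'] (hρ : IsBlowup ρ (C.comap ι)) {Γ : D.IdealSheafData}
    (hΓ : Γ ≤ C.comap ι) : (C.comap ι).comap ρ * controlledTransform ρ (C.comap ι) Γ 1 = Γ.comap ρ := by
  have hΓ1 : Γ ≤ C.comap ι ^ 1 := by rw [pow_one]; exact hΓ
  have h := pow_mul_controlledTransform_eq ρ (C.comap ι) (I := Γ) (μ := 1) hρ.isEffectiveCartier (comap_le_comap_pow_of_le_pow hΓ1 ρ)
  rwa [pow_one] at h

/-- A member THROUGH the point/curve `V(C)` in the sense of ideals (`B ≤ C`) restricts to a trace through `V(C|_D)` (`B|_D ≤ C|_D`). [folklore] -/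
theorem comap_le_comap_of_le {B : W.IdealSheafData} (hB : B ≤ C) : B.comap ι ≤ C.comap ι :=
  Scheme.IdealSheafData.comap_mono (f := ι) hB

end Summit.ResolutionOfSingularities.ResolutionOfSingularities.Theorems.SigmaMaxModificationsCorridor3.Sigma

end
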